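import Mathlib
import HarnessLib
import HarnessLib.Audit
import Summits.Langlands.Langlands.Theorems.RealCyclotomicDoorSplit
import Summits.Langlands.Langlands.Theorems.ModuliFieldDescentSplit

/-!
# ReductionSignatureSplitPrelude — lens-5 g33 node on CORE = `OddPrimeDoorSplit.CoreResidual` (§1–§4b)

Prelude of `ReductionSignatureSplit` (full account: the module docstring of `Summits.Langlands.Langlands.Theorems.ReductionSignatureSplit`): §1 the
REDUCTION-SIGNATURE dial above `p ∈ {3,5,7}` (`SupersingularPlace` = `v(j − j_ss(p)) > 0`; `signature_trichotomy`); §1b the loci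
`NOLocus` (door 4a at `3`), `SplitNOLocus` (door 4b, totally split `p`), `MixLocus` (door 5) and `OffSignatureDoors`; §2 the junctions
NOD₃ `NearlyOrdinaryDihedralDoorThree`, NOS `SplitOrdinaryDihedralDoor` (PRINT: Skinner–Wiles 2001 Thm. 5.1) and MIX `MixedSignatureDoor`
(GAP at `p ∈ {3,7}`: Pan 2022 Rem. 8.0.25); §3 the closed sectors and the declared residual RES33 `SignatureResidual`; §4 the kernel
`core_of_pieces : NOD₃ → NOS → MIX → RES33 → CORE` (0 sorry), `core_iff_signatureResidual`, `doors_cover_totallySplit`; §4b the joint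
kernel with g32's tree module `ModuliFieldDescentSplit` (PRIM33, `primitive_of_pieces`, `core_of_primitive_pieces`).  No `instance`,
no `notation`, no `sorry`.
-/

set_option linter.dupNamespace false
set_option linter.unusedVariables false

open scoped NumberField IntermediateField MatrixGroups
open NumberField IsDedekindDomain Field Literature.NumberTheory.Automorphic
open Literature.NumberTheory.GaloisRepresentations
open Summit.Langlands.Langlands.Theorems.DepthIsolationSplit (UnanchoredBox UnanchoredHighDegreeModularE
  IntegralModelTransferPointwise SatakeAvatarTwo satakeAvatarTwo_of_host)
open Summit.Langlands.Langlands.Theorems.JDegreeFilterSplit (jInv jDeg InResidualRange LargeJResidual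
  RatBaseChangeModularity SmallFieldBaseChange largeJResidual_of_restE)
open Summit.Langlands.Langlands.Theorems.DyadicDoorSplit (AllenLocus AllenDyadicCorollary DyadicDegenerateResidual
  residual_of_largeJResidual)
open Summit.Langlands.Langlands.Theorems.OddPrimeDoorSplit (Generic357 ModPAbsIrreducible PotMultAbove NoLocalMuAbove
  SWLocus OnSWDoor TotallySplitAt PotSupersingularAbove PZLocus OnPZDoor OffDoors CoreResidual
  SkinnerWilesDihedralDoor PanZhangSupersingularDoor residual_of_core core_of_residual largeJResidual_of_core
  restE_of_core core_of_largeJResidual core_of_restE)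
open Summit.Langlands.Langlands.Theorems.RealCyclotomicDoorSplit (BorelAt SplitCartanThree E7Seven BoxShape
  RefinedCore OnDisjointCell CellB3B5B7 CellS3B5B7 CellB3B5E7 CellS3B5E7 DisjointFieldCell EntangledFieldCell
  core_of_refined refined_of_core borelOrSplitCartanThree_iff borelOrE7Seven_iff disjointFieldCell_iff_levelCells)
open Summit.Langlands.Langlands.Theorems.ModuliFieldDescentSplit (JPrimitive PrimitiveCoreResidual PrimitiveRefinedCore
  AnchoredBPrimitiveModularity TotallyRealBaseChange prim_of_core)

namespace Summit.Langlands.Langlands.Theorems.ReductionSignatureSplit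

/-! ## §1 The dial: the reduction signature above `p` -/

/-- `v` is a (potentially) SUPERSINGULAR PLACE of `E` for the prime `p`: `v(j_E − j_ss(p)) > 0` with `j_ss(7) = 1728`,
`j_ss(p) = 0` otherwise — VERBATIM the pointwise clause of g30's `PotSupersingularAbove`. -/
def SupersingularPlace (K₀ : Type) [Field K₀] [NumberField K₀] (E : WeierstrassCurve (𝓞 K₀)) (p : ℕ)
    (v : HeightOneSpectrum (𝓞 K₀)) : Prop :=
  v.valuation K₀ (jInv K₀ E - ((if p = 7 then 1728 else 0 : ℕ) : K₀)) < 1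

/-- PURE NEARLY-ORDINARY SIGNATURE above `p`: no place above `p` is a supersingular place, i.e. `E` is potentially
ordinary or potentially multiplicative at every `v ∣ p` (`ρ_{E,p}|_{D_v}` nearly ordinary for all `v ∣ p`). -/
def NoSupersingularAbove (K₀ : Type) [Field K₀] [NumberField K₀] (E : WeierstrassCurve (𝓞 K₀)) (p : ℕ) : Prop :=
  ∀ v : HeightOneSpectrum (𝓞 K₀), (p : 𝓞 K₀) ∈ v.asIdeal → ¬ SupersingularPlace K₀ E p v

/-- Some place above `p` is a supersingular place of `E`. -/
def SomeSupersingularAbove (K₀ : Type) [Field K₀] [NumberField K₀] (E : WeierstrassCurve (𝓞 K₀)) (p : ℕ) : Prop :=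
  ∃ v : HeightOneSpectrum (𝓞 K₀), (p : 𝓞 K₀) ∈ v.asIdeal ∧ SupersingularPlace K₀ E p v

/-- Some place above `p` is a nearly-ordinary (potentially ordinary or multiplicative) place of `E`. -/
def SomeOrdinaryAbove (K₀ : Type) [Field K₀] [NumberField K₀] (E : WeierstrassCurve (𝓞 K₀)) (p : ℕ) : Prop :=
  ∃ v : HeightOneSpectrum (𝓞 K₀), (p : 𝓞 K₀) ∈ v.asIdeal ∧ ¬ SupersingularPlace K₀ E p v

/-- MIXED SIGNATURE above `p`: a supersingular place AND a nearly-ordinary place above `p`. -/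
def MixedSignatureAbove (K₀ : Type) [Field K₀] [NumberField K₀] (E : WeierstrassCurve (𝓞 K₀)) (p : ℕ) : Prop :=
  SomeSupersingularAbove K₀ E p ∧ SomeOrdinaryAbove K₀ E p

/-- g30's `PotSupersingularAbove` is the PURE SUPERSINGULAR signature (definitional). -/
theorem potSupersingularAbove_iff (K₀ : Type) [Field K₀] [NumberField K₀] (E : WeierstrassCurve (𝓞 K₀)) (p : ℕ) :
    PotSupersingularAbove K₀ E p ↔
      ∀ v : HeightOneSpectrum (𝓞 K₀), (p : 𝓞 K₀) ∈ v.asIdeal → SupersingularPlace K₀ E p v :=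
  Iff.rfl

/-- SIGNATURE TRICHOTOMY: above `p` the signature of `E` is pure supersingular, pure nearly-ordinary, or mixed. -/
theorem signature_trichotomy (K₀ : Type) [Field K₀] [NumberField K₀] (E : WeierstrassCurve (𝓞 K₀)) (p : ℕ) :
    PotSupersingularAbove K₀ E p ∨ NoSupersingularAbove K₀ E p ∨ MixedSignatureAbove K₀ E p := by
  by_cases hss : PotSupersingularAbove K₀ E p
  · exact Or.inl hss
  by_cases hno : NoSupersingularAbove K₀ E p
  · exact Or.inr (Or.inl hno)
  refine Or.inr (Or.inr ⟨?_, ?_⟩)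
  · by_contra h
    exact hno fun v hv hs => h ⟨v, hv, hs⟩
  · by_contra h
    exact hss fun v hv => by
      by_contra hs
      exact h ⟨v, hv, hs⟩

/-- The three signatures are mutually exclusive as soon as there IS a place above `p` (pure supersingular vs pure
nearly-ordinary), resp. unconditionally (mixed vs either pure one). -/
theorem not_mixed_of_pure (K₀ : Type) [Field K₀] [NumberField K₀] (E : WeierstrassCurve (𝓞 K₀)) (p : ℕ) :
    (PotSupersingularAbove K₀ E p ∨ NoSupersingularAbove K₀ E p) → ¬ MixedSignatureAbove K₀ E p := by
  rintro (h | h) ⟨⟨v, hv, hs⟩, ⟨w, hw, hn⟩⟩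
  · exact hn (h w hw)
  · exact h v hv hs

/-- Door 2's local clause implies door 4's: potentially MULTIPLICATIVE above `p` (`v(j) < 0`) ⇒ no supersingular place
above `p` (strict ultrametric inequality: `v(j − j_ss) = v(j)` as `j_ss` is an integer). -/
theorem noSupersingularAbove_of_potMultAbove {K₀ : Type} [Field K₀] [NumberField K₀] {E : WeierstrassCurve (𝓞 K₀)}
    {p : ℕ} (h : PotMultAbove K₀ E p) : NoSupersingularAbove K₀ E p := by
  intro v hv hs
  have hj : 1 < v.valuation K₀ (jInv K₀ E) := h v hv
  have hc : v.valuation K₀ (((if p = 7 then 1728 else 0 : ℕ) : K₀)) ≤ 1 := by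
    have h1 : v.valuation K₀ (algebraMap (𝓞 K₀) K₀ ((if p = 7 then 1728 else 0 : ℕ) : 𝓞 K₀)) ≤ 1 :=
      v.valuation_le_one _
    rwa [map_natCast] at h1
  have hlt : v.valuation K₀ (((if p = 7 then 1728 else 0 : ℕ) : K₀)) < v.valuation K₀ (jInv K₀ E) :=
    lt_of_le_of_lt hc hj
  have heq : v.valuation K₀ (jInv K₀ E - ((if p = 7 then 1728 else 0 : ℕ) : K₀)) = v.valuation K₀ (jInv K₀ E) :=
    Valuation.map_sub_eq_of_lt_left _ hlt
  unfold SupersingularPlace at hs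
  rw [heq] at hs
  exact lt_irrefl _ (lt_trans hj hs)

/-! ## §1b The three new loci and the door predicates -/

/-- THE NEARLY-ORDINARY DIHEDRAL LOCUS at `p`: `ρ̄_{E,p}` absolutely irreducible, NOT generic at `p` (dihedral, induced
from the quadratic subfield of `K₀(ζ_p)`), PURE NEARLY-ORDINARY signature above `p`, and `μ_p ⊄ K₀ᵥ` for all `v ∣ p`.
At `p = 3` this is EXACTLY Skinner–Wiles 2001 (5.1) + (i) for `ρ_{E,3}` (module docstring: `χ̄₂² = 1` at every
nearly-ordinary `3`-adic place, so `D_v`-distinguished ⟺ `μ₃ ⊄ K₀ᵥ`).  Contains g30's `SWLocus K₀ E p`. -/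
def NOLocus (K₀ : Type) [Field K₀] [NumberField K₀] (E : WeierstrassCurve (𝓞 K₀)) (p : ℕ) [Fact p.Prime] : Prop :=
  ModPAbsIrreducible K₀ E p ∧ ¬ ModPImageAbsIrreducibleOverCyclotomic (E.baseChange K₀) p ∧
    NoSupersingularAbove K₀ E p ∧ NoLocalMuAbove K₀ p

/-- DOOR 4a: `E` lies on the nearly-ordinary dihedral locus at `3`. -/
def OnNODoor (K₀ : Type) [Field K₀] [NumberField K₀] (E : WeierstrassCurve (𝓞 K₀)) : Prop :=
  NOLocus K₀ E 3

/-- THE SPLIT NEARLY-ORDINARY DIHEDRAL LOCUS at `p`: `p` totally split in `K₀` (`K₀ᵥ = ℚ_p`), `ρ̄_{E,p}` absolutely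
irreducible and NOT generic at `p` (dihedral), PURE NEARLY-ORDINARY signature above `p`.  On `K₀ᵥ = ℚ_p`,
`p ∈ {3,5,7}`, `D_v`-distinguishedness is automatic (module docstring: `χ̄₂²|_{I_v}` has order dividing `1, 2, 3`,
`ω|_{I_v}` has order `p − 1`), so this is Skinner–Wiles 2001 (5.1) + (i) for `ρ_{E,p}` with no `μ_p` clause.
Contains g30's `SWLocus K₀ E p` on totally split `p` (`splitNOLocus_of_swLocus`). -/
def SplitNOLocus (K₀ : Type) [Field K₀] [NumberField K₀] (E : WeierstrassCurve (𝓞 K₀)) (p : ℕ) [Fact p.Prime] :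
    Prop :=
  TotallySplitAt K₀ p ∧ ModPAbsIrreducible K₀ E p ∧ ¬ ModPImageAbsIrreducibleOverCyclotomic (E.baseChange K₀) p ∧
    NoSupersingularAbove K₀ E p

/-- DOOR 4b: `E` lies on the split nearly-ordinary dihedral locus at some `p ∈ {3, 5, 7}`. -/
def OnSplitNODoor (K₀ : Type) [Field K₀] [NumberField K₀] (E : WeierstrassCurve (𝓞 K₀)) : Prop :=
  ∃ (p : ℕ) (hp : p.Prime), (p = 3 ∨ p = 5 ∨ p = 7) ∧ @SplitNOLocus K₀ _ _ E p ⟨hp⟩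

/-- THE MIXED-SIGNATURE LOCUS at `p`: `p` totally split in `K₀` (`K₀ᵥ = ℚ_p` for all `v ∣ p`), `ρ̄_{E,p}` absolutely
irreducible (NO condition on `ρ̄|G_{K₀(ζ_p)}`, as in g30's `PZLocus`), and MIXED signature above `p` — the hypotheses of
X. Zhang 2024 Thm. 6.1.1 for `ρ_{E,p}` EXCEPT that `ρ|_{G_{ℚ_p}}` is absolutely irreducible only at SOME `v ∣ p` and
nearly ordinary (automatically distinguished, `e = 1`) at the others: Pan's "mixed situation". -/
def MixLocus (K₀ : Type) [Field K₀] [NumberField K₀] (E : WeierstrassCurve (𝓞 K₀)) (p : ℕ) [Fact p.Prime] : Prop :=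
  TotallySplitAt K₀ p ∧ ModPAbsIrreducible K₀ E p ∧ MixedSignatureAbove K₀ E p

/-- DOOR 5: `E` lies on the mixed-signature locus at some `p ∈ {3, 5, 7}`. -/
def OnMixDoor (K₀ : Type) [Field K₀] [NumberField K₀] (E : WeierstrassCurve (𝓞 K₀)) : Prop :=
  ∃ (p : ℕ) (hp : p.Prime), (p = 3 ∨ p = 5 ∨ p = 7) ∧ @MixLocus K₀ _ _ E p ⟨hp⟩

/-- OFF THE THREE SIGNATURE DOORS (4a, 4b, 5) — the residual dial of this node. -/
def OffSignatureDoors (K₀ : Type) [Field K₀] [NumberField K₀] (E : WeierstrassCurve (𝓞 K₀)) : Prop :=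
  ¬ OnNODoor K₀ E ∧ ¬ OnSplitNODoor K₀ E ∧ ¬ OnMixDoor K₀ E

/-- Door 2 ⊆ door 4a, prime by prime: the Skinner–Wiles locus lies in the nearly-ordinary dihedral locus. -/
theorem noLocus_of_swLocus {K₀ : Type} [Field K₀] [NumberField K₀] {E : WeierstrassCurve (𝓞 K₀)} {p : ℕ}
    [Fact p.Prime] (h : SWLocus K₀ E p) : NOLocus K₀ E p :=
  ⟨h.1, h.2.1, noSupersingularAbove_of_potMultAbove h.2.2.1, h.2.2.2⟩

/-- In particular g30's door 2 AT `3` is part of door 4a. -/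
theorem onNODoor_of_swLocus_three {K₀ : Type} [Field K₀] [NumberField K₀] {E : WeierstrassCurve (𝓞 K₀)}
    (h : SWLocus K₀ E 3) : OnNODoor K₀ E :=
  noLocus_of_swLocus h

/-- Door 2 ⊆ door 4b on a totally split `p`. -/
theorem splitNOLocus_of_swLocus {K₀ : Type} [Field K₀] [NumberField K₀] {E : WeierstrassCurve (𝓞 K₀)} {p : ℕ}
    [Fact p.Prime] (hts : TotallySplitAt K₀ p) (h : SWLocus K₀ E p) : SplitNOLocus K₀ E p :=
  ⟨hts, h.1, h.2.1, noSupersingularAbove_of_potMultAbove h.2.2.1⟩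

/-! ## §2 The junctions (doors 4a, 4b and 5), E-level, for every totally real field -/

/-- NOD₃ — NEARLY-ORDINARY DIHEDRAL DOOR AT `3` (PRINT junction, E-level, every totally real `K`; binder, credits
nothing; CONTAINS `SkinnerWilesDihedralDoor` restricted to `p = 3`): an integral `E` (`Δ ≠ 0`) over a totally real `K`
on `NOLocus K E 3` is modular.  Print chain: (1) `ρ = ρ_{E,3}` satisfies Skinner–Wiles (5.1): continuous, irreducible,
unramified a.e., totally odd, `det ρ = ε`, NEARLY ORDINARY at each `v ∣ 3` — potentially multiplicative places as in
g30, potentially good ORDINARY places by descent of the canonical étale quotient (`NoSupersingularAbove`); (2) `ρ̄^ss =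
ρ̄` irreducible (`ModPAbsIrreducible`) and `D_v`-distinguished for all `v ∣ 3`: the ordinary reduction has `j̃ ≠ 0`,
`Aut = ±1`, the semistabilising twist is quadratic, `χ̄₂² = 1`, `χ̄₁χ̄₂ = ω`, so distinguished ⟺ `ω|_{D_v} ≠ 1` ⟺
`NoLocalMuAbove K 3`; (3) `ρ̄ ≃ Ind χ̄` from `K(√-3)` (not generic + absolutely irreducible: image `C_s⁺(3)`,
`ρ̄(G_{K(ζ₃)}) = C_s⁺(3) ∩ SL₂(𝔽₃)` cyclic of order `4`), and the weight-one theta series of the Teichmüller lift of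
`χ̄` is `U_v`-ordinary at every `v ∣ 3` (all RAMIFIED in `K(ζ₃)/K` since `μ₃ ⊄ Kᵥ`), hence sits in a nearly ordinary
Hida family whose weight-`2` members give the `χ₂`-good nearly ordinary lift `π₀` of (ii) [Wiles1988; Hida1989];
(4) Thm. 5.1 [SkinnerWiles2001, Thm. 5.1, p. 204]: `ρ ≃ ρ_π`, so `E` is modular.  NOT in the tree (no Skinner–Wiles
2001 fact is vendored).  [ref: SkinnerWiles2001, Thm. 5.1] [ref: Wiles1988] [ref: Pan2022, Rem. 8.0.25 ("ordinary,
… can be proved by using Hida families [SW01]")] -/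
def NearlyOrdinaryDihedralDoorThree : Prop :=
  ∀ (K : Type) [Field K] [NumberField K] [IsTotallyReal K] (E : WeierstrassCurve (𝓞 K)), E.Δ ≠ 0 →
    NOLocus K E 3 → IsModularEllipticCurve K E

/-- NOS — SPLIT NEARLY-ORDINARY DIHEDRAL DOOR (PRINT junction, E-level, every totally real `K` in which `p` splits
completely; binder, credits nothing; CONTAINS `SkinnerWilesDihedralDoor` on totally split `p`): an integral `E`
(`Δ ≠ 0`) over a totally real `K` on `SplitNOLocus K E p` for some `p ∈ {3, 5, 7}` is modular.  Print chain = NOD₃'s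
(1)–(4) at `p`: (1) `ρ_{E,p}` satisfies Skinner–Wiles (5.1), nearly ordinary at every `v ∣ p` (`NoSupersingularAbove`);
(2) `ρ̄` irreducible and `D_v`-DISTINGUISHED AUTOMATICALLY since `Kᵥ = ℚ_p` (Serre–Tate: the semistabilising inertia
embeds in `Aut(Ẽ)`, cyclic of order dividing `2, 4, 6` for an ordinary reduction in characteristic `3, 5, 7`, so
`χ̄₂²|_{I_v}` has order dividing `1, 2, 3` while `ω|_{I_v}` has order `p − 1 = 2, 4, 6`; potentially multiplicative
places: `χ̄₂² = 1`); (3) residual automorphy with a `χ₂`-good nearly ordinary lift exactly as in g30's door-2 chain (3)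
at `p` (theta series / automorphic induction from the quadratic subfield of `K(ζ_p)`, made ordinary by a global
finite-order twist and moved to weight `2` in its Hida family [Wiles1988; Hida1989]); (4) [SkinnerWiles2001, Thm. 5.1].
X. Zhang 2024, Rem. 6.1.2 [arXiv:2412.06812, p. 33]: "In the ordinary case, the result is known by [SW01], [Kisin09],
[HuTan15]."  At `p = 5` (where `K(√5)` is totally real, `√5 ∉ ℚ₅`) ALSO Thorne 2016, Thm. 7.5 (tree fact
`Thorne2016_theorem7_5_ellipticCurve`, any signature).  NOT derived in the tree.  [ref: SkinnerWiles2001, Thm. 5.1]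
[ref: XZhang2024, Rem. 6.1.2] [ref: Thorne2016, Thm. 7.5] -/
def SplitOrdinaryDihedralDoor : Prop :=
  ∀ (K : Type) [Field K] [NumberField K] [IsTotallyReal K] (E : WeierstrassCurve (𝓞 K)), E.Δ ≠ 0 →
    ∀ (p : ℕ) [Fact p.Prime], (p = 3 ∨ p = 5 ∨ p = 7) → SplitNOLocus K E p → IsModularEllipticCurve K E

/-- MIX — MIXED-SIGNATURE DOOR (GAP / IDEA-NEEDED junction, E-level, every totally real `K` in which `p` splits
completely; binder, credits nothing): an integral `E` (`Δ ≠ 0`) over a totally real `K` on `MixLocus K E p` for some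
`p ∈ {3, 5, 7}` is modular.  NOT IN PRINT: the required lifting theorem — X. Zhang 2024 Thm. 6.1.1 / Pan 2022 Thm. 1.0.2
with "`ρ|_{G_{F_v}}` absolutely irreducible for all `v ∣ p`" weakened to "for some `v ∣ p`, nearly ordinary and
distinguished at the others" — is the programme Pan 2022 Remark 8.0.25 names and leaves open ("mixture of completed
cohomology and Hida family: the ordinary parts of the completed cohomology at places where `ρ|_{G_{F_v}}` is
reducible … We leave the details to the interested readers").  The remaining hypotheses hold for `ρ_{E,p}` exactly as
in g30's door 3 (finitely ramified, odd, de Rham of weights `{0,1}`; residual automorphy by FLS on door 1 and by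
automorphic induction / congruence lift off door 1).  WHERE THE GAP IS: at `p ∈ {3, 7}` only.  At `p = 5` a totally
split `5` forces `√5 ∉ K` (`√5 ∉ ℚ₅`), so the quadratic subfield `K(√5)` of `K(ζ₅)/K` is TOTALLY REAL and the dihedral
case is Thorne 2016, Thm. 7.5 (= Thm. 1.2) in EVERY signature — tree fact `Thorne2016_theorem7_5_ellipticCurve`
(`Literature/NumberTheory/Automorphic/ResiduallyDihedralAutomorphyLifting.lean`; not derived here: its hypothesis (a)
is a matrix rendering of "`ρ̄|_{G_{K(ζ₅)}}` is a sum of two distinct characters" that `¬ ModPImageAbsIrreducibleOver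
Cyclotomic` does not give for free) — and the generic case is FLS Thm. 4; at `p = 3, 7` the quadratic subfield
`K(√-3)`, `K(√-7)` is CM and no printed theorem covers the mixed signature.  [ref: Pan2022, Rem. 8.0.25]
[ref: XZhang2024, Thm. 6.1.1, Rem. 6.1.2] [ref: Thorne2016, Thm. 7.5] -/
def MixedSignatureDoor : Prop :=
  ∀ (K : Type) [Field K] [NumberField K] [IsTotallyReal K] (E : WeierstrassCurve (𝓞 K)), E.Δ ≠ 0 →
    ∀ (p : ℕ) [Fact p.Prime], (p = 3 ∨ p = 5 ∨ p = 7) → MixLocus K E p → IsModularEllipticCurve K E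

/-! ## §3 The pieces: three door sectors (closed modulo the junctions) and the declared residual -/

/-- NO — the nearly-ordinary sector of CORE at `3` (CLOSED from NOD₃: `noSector_closed`). -/
def NOSector : Prop :=
  ∀ (K₀ : Type) [Field K₀] [NumberField K₀], UnanchoredBox K₀ →
    ∀ E : WeierstrassCurve (𝓞 K₀), E.Δ ≠ 0 → InResidualRange K₀ E → ¬ AllenLocus K₀ E → OnNODoor K₀ E →
      IsModularEllipticCurve K₀ E

/-- SNO — the split nearly-ordinary sector of CORE (CLOSED from NOS: `splitNOSector_closed`). -/
def SplitNOSector : Prop :=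
  ∀ (K₀ : Type) [Field K₀] [NumberField K₀], UnanchoredBox K₀ →
    ∀ E : WeierstrassCurve (𝓞 K₀), E.Δ ≠ 0 → InResidualRange K₀ E → ¬ AllenLocus K₀ E → OnSplitNODoor K₀ E →
      IsModularEllipticCurve K₀ E

/-- MX — the mixed-signature sector of CORE (CLOSED from MIX: `mixSector_closed`). -/
def MixSector : Prop :=
  ∀ (K₀ : Type) [Field K₀] [NumberField K₀], UnanchoredBox K₀ →
    ∀ E : WeierstrassCurve (𝓞 K₀), E.Δ ≠ 0 → InResidualRange K₀ E → ¬ AllenLocus K₀ E → OnMixDoor K₀ E →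
      IsModularEllipticCurve K₀ E

/-- RES33 — THE DECLARED RESIDUAL of this node (IDEA-NEEDED; no print): CORE off doors 4a, 4b and 5.  An integral `E`
over an unanchored totally real `K₀` (degree `≥ 6`), `[ℚ(j):ℚ]` in the residual range, off the Allen locus, off g30's
doors 1–3, NOT on the nearly-ordinary dihedral locus at `3` (so: a Borel framing at `3`, or a supersingular place above
`3`, or `μ₃ ⊂ K₀ᵥ` for some `v ∣ 3`) and on NO totally-split pure-nearly-ordinary dihedral locus and NO totally-split
mixed-signature locus at `3, 5, 7`, is modular. -/
def SignatureResidual : Prop :=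
  ∀ (K₀ : Type) [Field K₀] [NumberField K₀], UnanchoredBox K₀ →
    ∀ E : WeierstrassCurve (𝓞 K₀), E.Δ ≠ 0 → InResidualRange K₀ E → ¬ AllenLocus K₀ E → OffDoors K₀ E →
      OffSignatureDoors K₀ E → IsModularEllipticCurve K₀ E

/-! ## §4 KERNEL: CORE ⟸ NOD₃ ∧ NOS ∧ MIX ∧ RES33, and exactness -/

/-- NO sector CLOSED from the junction NOD₃. -/
theorem noSector_closed (hNOD : NearlyOrdinaryDihedralDoorThree) : NOSector := by
  intro K₀ _ _ hb E hΔ hr hA hn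
  haveI : IsTotallyReal K₀ := hb.1
  exact hNOD K₀ E hΔ hn

/-- MX sector CLOSED from the junction MIX. -/
theorem mixSector_closed (hMIX : MixedSignatureDoor) : MixSector := by
  intro K₀ _ _ hb E hΔ hr hA hm
  haveI : IsTotallyReal K₀ := hb.1
  obtain ⟨p, hp, hp357, hmix⟩ := hm
  haveI : Fact p.Prime := ⟨hp⟩
  exact hMIX K₀ E hΔ p hp357 hmix

/-- SNO sector CLOSED from the junction NOS. -/
theorem splitNOSector_closed (hNOS : SplitOrdinaryDihedralDoor) : SplitNOSector := by
  intro K₀ _ _ hb E hΔ hr hA hs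
  haveI : IsTotallyReal K₀ := hb.1
  obtain ⟨p, hp, hp357, hsl⟩ := hs
  haveI : Fact p.Prime := ⟨hp⟩
  exact hNOS K₀ E hΔ p hp357 hsl

/-- POINTWISE: the three junctions close every curve that is ON a signature door. -/
theorem modular_of_not_offSignatureDoors (hNOD : NearlyOrdinaryDihedralDoorThree) (hNOS : SplitOrdinaryDihedralDoor)
    (hMIX : MixedSignatureDoor) {K₀ : Type} [Field K₀] [NumberField K₀] [IsTotallyReal K₀]
    (E : WeierstrassCurve (𝓞 K₀)) (hΔ : E.Δ ≠ 0) (h : ¬ OffSignatureDoors K₀ E) : IsModularEllipticCurve K₀ E := by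
  by_cases hn : OnNODoor K₀ E
  · exact hNOD K₀ E hΔ hn
  by_cases hs : OnSplitNODoor K₀ E
  · obtain ⟨p, hp, hp357, hsl⟩ := hs
    haveI : Fact p.Prime := ⟨hp⟩
    exact hNOS K₀ E hΔ p hp357 hsl
  by_cases hm : OnMixDoor K₀ E
  · obtain ⟨p, hp, hp357, hmix⟩ := hm
    haveI : Fact p.Prime := ⟨hp⟩
    exact hMIX K₀ E hΔ p hp357 hmix
  exact (h ⟨hn, hs, hm⟩).elim

/-- KERNEL (0 sorry): NOD₃ → NOS → MIX → RES33 → CORE (excluded middle on doors 4a, 4b and 5). -/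
theorem core_of_pieces (hNOD : NearlyOrdinaryDihedralDoorThree) (hNOS : SplitOrdinaryDihedralDoor)
    (hMIX : MixedSignatureDoor) (hR : SignatureResidual) : CoreResidual := by
  intro K₀ _ _ hb E hΔ hr hA hoff
  haveI : IsTotallyReal K₀ := hb.1
  by_cases h33 : OffSignatureDoors K₀ E
  · exact hR K₀ hb E hΔ hr hA hoff h33
  · exact modular_of_not_offSignatureDoors hNOD hNOS hMIX E hΔ h33

/-- NECESSITY: CORE ⟹ RES33 (a sub-family: one more hypothesis). -/
theorem signatureResidual_of_core (h : CoreResidual) : SignatureResidual :=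
  fun K₀ _ _ hb E hΔ hr hA hoff _ => h K₀ hb E hΔ hr hA hoff

/-- The three sectors are sub-families of g28's RES (CORE's grandparent `DyadicDegenerateResidual`). -/
theorem sectors_of_residual (h : DyadicDegenerateResidual) : NOSector ∧ SplitNOSector ∧ MixSector :=
  ⟨fun K₀ _ _ hb E hΔ hr hA _ => h K₀ hb E hΔ hr hA, fun K₀ _ _ hb E hΔ hr hA _ => h K₀ hb E hΔ hr hA,
    fun K₀ _ _ hb E hΔ hr hA _ => h K₀ hb E hΔ hr hA⟩

/-- EXACTNESS: modulo the three junctions, CORE ⟺ RES33. -/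
theorem core_iff_signatureResidual (hNOD : NearlyOrdinaryDihedralDoorThree) (hNOS : SplitOrdinaryDihedralDoor)
    (hMIX : MixedSignatureDoor) : CoreResidual ↔ SignatureResidual :=
  ⟨signatureResidual_of_core, core_of_pieces hNOD hNOS hMIX⟩

/-- COVERAGE at a totally split `p`: a curve with `E[p]` absolutely irreducible and not generic at `p` lies on g30's
door 3 (pure supersingular), on door 4b (pure nearly-ordinary) or on door 5 (mixed) at `p` — by the signature
trichotomy; nothing of it is left in RES33. -/
theorem doors_cover_totallySplit {K₀ : Type} [Field K₀] [NumberField K₀] (E : WeierstrassCurve (𝓞 K₀)) (p : ℕ)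
    [Fact p.Prime] (hts : TotallySplitAt K₀ p) (hirr : ModPAbsIrreducible K₀ E p)
    (hng : ¬ ModPImageAbsIrreducibleOverCyclotomic (E.baseChange K₀) p) :
    PZLocus K₀ E p ∨ SplitNOLocus K₀ E p ∨ MixLocus K₀ E p := by
  rcases signature_trichotomy K₀ E p with hss | hno | hmix
  · exact Or.inl ⟨hts, hirr, hss⟩
  · exact Or.inr (Or.inl ⟨hts, hirr, hng, hno⟩)
  · exact Or.inr (Or.inr ⟨hts, hirr, hmix⟩)

/-- Hence at a totally split `p ∈ {3,5,7}` RES33 only contains curves whose `E[p]` is NOT absolutely irreducible (a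
Borel framing at `p`: FLS Prop. 9.1 (a) at `3`; the `105`-level structures of g31 at `5`, `7`) — the residually
reducible barrier locus.  The dihedral part of RES33 lives above the NON-split primes. -/
theorem not_modPAbsIrreducible_of_offDoors_split {K₀ : Type} [Field K₀] [NumberField K₀]
    (E : WeierstrassCurve (𝓞 K₀)) (p : ℕ) (hp : p.Prime) (hp357 : p = 3 ∨ p = 5 ∨ p = 7)
    (hts : TotallySplitAt K₀ p) (hoff : OffDoors K₀ E) (hoff33 : OffSignatureDoors K₀ E) :
    ¬ @ModPAbsIrreducible K₀ _ _ E p ⟨hp⟩ := by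
  haveI : Fact p.Prime := ⟨hp⟩
  intro hirr
  have hng : ¬ ModPImageAbsIrreducibleOverCyclotomic (E.baseChange K₀) p :=
    fun himg => hoff.1 ⟨p, hp, hp357, himg⟩
  rcases doors_cover_totallySplit E p hts hirr hng with hpz | hno | hmix
  · exact hoff.2.2 ⟨p, hp, hp357, hpz⟩
  · exact hoff33.2.1 ⟨p, hp, hp357, hno⟩
  · exact hoff33.2.2 ⟨p, hp, hp357, hmix⟩

/-! ## §4b Joint with g32 (`ModuliFieldDescentSplit`, tree): the signature dial on the j-PRIMITIVE residual PRIM -/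

/-- PRIM33 — g32's PRIM (`PrimitiveCoreResidual`: CORE on the j-primitive pairs `ℚ(j(E)) = K₀`) off the three
signature doors.  The two dials commute: one reads `[ℚ(j):ℚ]`, the other `E[p]` and the `p`-adic valuations of `j`. -/
def PrimitiveSignatureResidual : Prop :=
  ∀ (K₀ : Type) [Field K₀] [NumberField K₀], UnanchoredBox K₀ →
    ∀ E : WeierstrassCurve (𝓞 K₀), E.Δ ≠ 0 → InResidualRange K₀ E → ¬ AllenLocus K₀ E → OffDoors K₀ E →
      JPrimitive K₀ E → OffSignatureDoors K₀ E → IsModularEllipticCurve K₀ E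

/-- PRIM ⟸ NOD₃ ∧ NOS ∧ MIX ∧ PRIM33. -/
theorem primitive_of_pieces (hNOD : NearlyOrdinaryDihedralDoorThree) (hNOS : SplitOrdinaryDihedralDoor)
    (hMIX : MixedSignatureDoor) (hR : PrimitiveSignatureResidual) : PrimitiveCoreResidual := by
  intro K₀ _ _ hb E hΔ hr hA hoff hprim
  haveI : IsTotallyReal K₀ := hb.1
  by_cases h33 : OffSignatureDoors K₀ E
  · exact hR K₀ hb E hΔ hr hA hoff hprim h33
  · exact modular_of_not_offSignatureDoors hNOD hNOS hMIX E hΔ h33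

/-- PRIM ⟹ PRIM33. -/
theorem primitiveSignature_of_primitive (h : PrimitiveCoreResidual) : PrimitiveSignatureResidual :=
  fun K₀ _ _ hb E hΔ hr hA hoff hprim _ => h K₀ hb E hΔ hr hA hoff hprim

/-- RES33 ⟹ PRIM33 (the two cuts are transverse; this is the trivial corner). -/
theorem primitiveSignature_of_signatureResidual (h : SignatureResidual) : PrimitiveSignatureResidual :=
  fun K₀ _ _ hb E hΔ hr hA hoff _ h33 => h K₀ hb E hΔ hr hA hoff h33

/-- EXACTNESS (PRIM version): modulo the three junctions, PRIM ⟺ PRIM33. -/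
theorem primitive_iff_primitiveSignature (hNOD : NearlyOrdinaryDihedralDoorThree) (hNOS : SplitOrdinaryDihedralDoor)
    (hMIX : MixedSignatureDoor) : PrimitiveCoreResidual ↔ PrimitiveSignatureResidual :=
  ⟨primitiveSignature_of_primitive, primitive_of_pieces hNOD hNOS hMIX⟩

/-- KERNEL joint with g32: g32's `core_of_pieces` (tree) with PRIM replaced by NOD₃ ∧ NOS ∧ MIX ∧ PRIM33. -/
theorem core_of_primitive_pieces (hADC : AllenDyadicCorollary) (h34 : FLS2015_theorems3_4)
    (hSW : SkinnerWilesDihedralDoor) (hPZ : PanZhangSupersingularDoor) (hY : Yoshikawa2019_theorem1_2)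
    (hTh : Thorne2019_thm1) (hQ4 : Summit.Langlands.Langlands.Theses.EllipticDegreeLadder.QuarticModularity)
    (hQ5 : Summit.Langlands.Langlands.Theses.EllipticDegreeLadder.QuinticModularity)
    (hAPB : AnchoredBPrimitiveModularity) (hBC : TotallyRealBaseChange) (hNOD : NearlyOrdinaryDihedralDoorThree)
    (hNOS : SplitOrdinaryDihedralDoor) (hMIX : MixedSignatureDoor) (hR : PrimitiveSignatureResidual) :
    CoreResidual :=
  Summit.Langlands.Langlands.Theorems.ModuliFieldDescentSplit.core_of_pieces hADC h34 hSW hPZ hY hTh hQ4 hQ5 hAPB hBC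
    (primitive_of_pieces hNOD hNOS hMIX hR)

end Summit.Langlands.Langlands.Theorems.ReductionSignatureSplit
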